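import Literature.NumberTheory.EllipticCurves.PadicSigmaSqMinusTwistPinningProofs
import Literature.NumberTheory.EllipticCurves.CanonicalPAdicHeightAdmissibleProofs
import Literature.NumberTheory.EllipticCurves.X049TwistCMSigmaSqTwoProofs
import HarnessLib

/-!
# Uniqueness of the minus-twist height datum, and the binder-free instance on the `−1`-twists of
# `49a1^{(4k+1)}` (proofs only)

Topic `Literature/NumberTheory/EllipticCurves` (trunk T-NT-EC). Pure proof file (no definition, no
named fact), sequel of `PadicSigmaSqMinusTwistPinningProofs.lean`. Width seat `bsd-line-cf2-p1-w5`
(g20) of the cell `bsd-print-cf2`, in support of stmt-BirchSwinnertonDyer-20368 (road (C)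
`disegni-pair-two`, pinning stub `stub_pin_minusTwist_two` = ty2's residue (R1)). BSD is not proved by
any of this.

* §1 `hasNonsingularMinusReductionAt_of_twistModel` — the converse dictionary: the integral twist
  model's non-singular reduction at an odd prime gives the receptacle's `HasNonsingularMinusReductionAt`;
* §2 `exists_isAdmissibleMinusTwist_nsmul` (**admissible multiples exist for the receptacle**,
  `d ∈ {−1, 2, −2}`), `PAdicHeightData.isCanonicalSqMinusTwist_unique` (**two data with
  `IsCanonicalSqMinusTwist` coincide**), `existsUnique_isCanonicalSqMinusTwist_neg_one`
  (**`∃! D`, `d = −1`**, for `V` elliptic `ℤ`-integral with a sigma-squared pair at `2`);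
* §3 `cm7Twist_existsUnique_isCanonicalSqMinusTwist_neg_one` — **binder-free on the `−1`-twists of
  `W_k = 49a1^{(4k+1)}`** (the pair at `2` is the square of the CM sigma function,
  `cm7Twist_exists_isMazurTateSigmaSqPair_two`): the `∀ D, IsCanonicalSqMinusTwist D → …` binder of
  Bertrand's `bertrand_pairingSqMinusTwist_self_ne_zero_two` is instantiated, uniquely, for `d = −1`.

## Sources

* B. Mazur, W. Stein, J. Tate, Doc. Math. Extra Vol. Coates (2006), §1 («extends uniquely»), §2.7.
  [MazurSteinTate2006]
* J. H. Silverman, Math. Ann. 332 (2005), §5 Rem. 2. [Silverman2005DivPoly]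
* B. Perrin-Riou, Mém. SMF 17 (1984), Ch. III §1.2 Lemme 2. [Perrinriou1984]
* J. H. Silverman, *The Arithmetic of Elliptic Curves*, 2nd ed. (2009), VII.2, VII.6. [SilvermanAEC2009]
-/

noncomputable section

open scoped Classical
open PowerSeries Literature.NumberTheory.EllipticCurves

namespace WeierstrassCurve

/-! ### §1 From the local conditions on the integral twist model back to the receptacle -/

section Converse

variable (V : WeierstrassCurve ℚ) (d : ℤ) (W : WeierstrassCurve ℚ)

/-- `v_ℓ(2) = 0` and `v_ℓ(d) = 0` for an odd prime `ℓ` and `d ∈ {−1, 2, −2}` (private plumbing). [folklore] -/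
private theorem padicValRat_two_d_eq_zero' {ℓ : ℕ} [Fact ℓ.Prime] (hℓ2 : ℓ ≠ 2) {d : ℤ}
    (hd : d = -1 ∨ d = 2 ∨ d = -2) : padicValRat ℓ (2 : ℚ) = 0 ∧ padicValRat ℓ (d : ℚ) = 0 := by
  have h2 : padicValRat ℓ (2 : ℚ) = 0 := by
    have : padicValNat ℓ 2 = 0 := padicValNat.eq_zero_of_not_dvd fun h =>
      hℓ2 ((Nat.prime_dvd_prime_iff_eq (Fact.out : ℓ.Prime) Nat.prime_two).mp h)
    rw [show (2 : ℚ) = ((2 : ℕ) : ℚ) by norm_num, padicValRat.of_nat, this, Nat.cast_zero]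
  refine ⟨h2, ?_⟩
  rcases hd with rfl | rfl | rfl
  · rw [Int.cast_neg, Int.cast_one, padicValRat.neg, padicValRat.one]
  · rw [Int.cast_ofNat]; exact h2
  · push_cast; rw [padicValRat.neg]; exact h2

/-- **The integral twist model's local conditions imply the receptacle's.** For `d ∈ {−1, 2, −2}`,
`(2,0,0,0) • W = V^{(d)}` and `(X₁, Y₁) ∈ W(ℚ)` with `‖X₁‖₂ > 1` and non-singular reduction on `W` at an
odd prime `ℓ`, the receptacle's condition `HasNonsingularMinusReductionAt d ℓ (X₁/(4d))` holds
(`Φ_x = −16d²f′(x′)`, `Φ_y = 2Y₁`, `Y₁² = 64d³f(x′)`). [Mazur–Stein–Tate 2006, §1; Silverman AEC VII.2]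
[cite: MazurSteinTate2006, §1] -/
theorem hasNonsingularMinusReductionAt_of_twistModel (hd : d = -1 ∨ d = 2 ∨ d = -2)
    (hW : (⟨Units.mk0 (2 : ℚ) two_ne_zero, 0, 0, 0⟩ : VariableChange ℚ) • W = V.quadraticTwist (d : ℚ))
    {X₁ Y₁ : ℚ} (h₁ : W.toAffine.Nonsingular X₁ Y₁) {ℓ : ℕ} (hℓ : ℓ.Prime) (hℓ2 : ℓ ≠ 2)
    (hns : W.HasNonsingularReductionAt ℓ X₁ Y₁) :
    V.HasNonsingularMinusReductionAt (d : ℚ) ℓ (X₁ / 4 / (d : ℚ)) := by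
  obtain ⟨ha1, ha2, ha3, ha4, ha6⟩ := V.coeffs_of_scaleTwo_smul_eq d W hW
  have hd0 : (d : ℚ) ≠ 0 := by rcases hd with rfl | rfl | rfl <;> norm_num
  haveI : Fact ℓ.Prime := ⟨hℓ⟩
  obtain ⟨hv2, hvd⟩ := padicValRat_two_d_eq_zero' hℓ2 hd
  set x' : ℚ := X₁ / 4 / (d : ℚ) with hx'
  have hX₁ : X₁ = 4 * (d : ℚ) * x' := by rw [hx']; field_simp
  have hΦx : W.toAffine.polynomialX.evalEval X₁ Y₁ =
      -(16 * (d : ℚ) ^ 2) * (3 * x' ^ 2 + V.b₂ / 2 * x' + V.b₄ / 2) := by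
    rw [Affine.evalEval_polynomialX, ha1, ha2, ha4, hX₁]; ring
  have hΦy : W.toAffine.polynomialY.evalEval X₁ Y₁ = 2 * Y₁ := by
    rw [Affine.evalEval_polynomialY, ha1, ha3]; ring
  have heq : Y₁ ^ 2 = 64 * (d : ℚ) ^ 3 * (x' ^ 3 + V.b₂ / 4 * x' ^ 2 + V.b₄ / 2 * x' + V.b₆ / 4) := by
    have := h₁.1
    rw [Affine.equation_iff, ha1, ha2, ha3, ha4, ha6, hX₁] at this
    linear_combination this
  have h4 : padicValRat ℓ (4 : ℚ) = 0 := by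
    rw [show (4 : ℚ) = 2 ^ 2 by norm_num, padicValRat.pow, hv2, mul_zero]
  have hc16 : -(16 * (d : ℚ) ^ 2) ≠ 0 := neg_ne_zero.mpr (mul_ne_zero (by norm_num) (pow_ne_zero 2 hd0))
  have h16 : padicValRat ℓ (-(16 * (d : ℚ) ^ 2)) = 0 := by
    rw [padicValRat.neg, padicValRat.mul (by norm_num) (pow_ne_zero 2 hd0),
      show (16 : ℚ) = 2 ^ 4 by norm_num, padicValRat.pow, padicValRat.pow, hv2, hvd]; ring
  have hc64 : 64 * (d : ℚ) ^ 3 ≠ 0 := mul_ne_zero (by norm_num) (pow_ne_zero 3 hd0)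
  have h64 : padicValRat ℓ (64 * (d : ℚ) ^ 3) = 0 := by
    rw [padicValRat.mul (by norm_num) (pow_ne_zero 3 hd0), show (64 : ℚ) = 2 ^ 6 by norm_num,
      padicValRat.pow, padicValRat.pow, hv2, hvd]; ring
  simp only [HasNonsingularMinusReductionAt]
  rcases hns with hlt | ⟨hx0, hxv⟩ | ⟨hy0, hyv⟩
  · -- `X₁` has negative valuation, hence so has `x′ = X₁/(4d)`
    refine Or.inl ?_
    have hX0 : X₁ ≠ 0 := by rintro h; rw [h, padicValRat.zero] at hlt; exact lt_irrefl _ hlt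
    have hx0 : x' ≠ 0 := by
      intro h; apply hX0; rw [hX₁, h, mul_zero]
    have := hlt
    rw [hX₁, padicValRat.mul (mul_ne_zero (by norm_num) hd0) hx0, padicValRat.mul (by norm_num) hd0,
      h4, hvd] at this
    simpa using this
  · -- `Φ_x = −16d²·f′(x′)` is an `ℓ`-unit
    refine Or.inr (Or.inl ⟨?_, ?_⟩)
    · intro h; apply hx0; rw [hΦx, h, mul_zero]
    · have hf'0 : (3 * x' ^ 2 + V.b₂ / 2 * x' + V.b₄ / 2) ≠ 0 := by
        intro h; apply hx0; rw [hΦx, h, mul_zero]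
      rw [hΦx, padicValRat.mul hc16 hf'0, h16, zero_add] at hxv
      exact hxv
  · -- `Φ_y = 2Y₁` is an `ℓ`-unit, hence `Y₁` and `f(x′) = Y₁²/(64d³)` are
    rw [hΦy] at hy0 hyv
    have hY0 : Y₁ ≠ 0 := by rintro rfl; exact hy0 (by ring)
    rw [padicValRat.mul two_ne_zero hY0, hv2, zero_add] at hyv
    have hf0 : (x' ^ 3 + V.b₂ / 4 * x' ^ 2 + V.b₄ / 2 * x' + V.b₆ / 4) ≠ 0 := by
      intro h; rw [h, mul_zero] at heq; exact hY0 (pow_eq_zero_iff two_ne_zero |>.mp heq)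
    refine Or.inr (Or.inr ⟨hvd, hf0, ?_⟩)
    have := congrArg (padicValRat ℓ) heq
    rw [padicValRat.pow, padicValRat.mul hc64 hf0, h64, hyv] at this
    simpa using this.symm

end Converse

/-! ### §2 Admissible multiples for the receptacle; uniqueness -/

section Unique

variable (V : WeierstrassCurve ℚ) [V.IsElliptic] [V.IsIntegral ℤ] (d : ℤ)

/-- **Admissible multiples exist for the minus-twist receptacle**: for `V/ℚ` elliptic `ℤ`-integral and
`d ∈ {−1, 2, −2}`, every non-torsion `P ∈ V^{(d)}(ℚ)` has a multiple `mP`, `m ≠ 0`, satisfying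
`IsAdmissibleMinusTwist V 2 d` — the admissible multiple of `(4X, 8Y)` on the integral twist model
(`exists_admissible_nsmul_of_isIntegral`), read back through `(X, Y) ↦ (4X, 8Y)` and §1.
[Silverman AEC VII.6.1–6.2, VII.2.1–2.2; Mazur–Stein–Tate 2006, §1] [cite: SilvermanAEC2009, VII.6 Cor. 6.2 (PDF p. 177)] -/
theorem exists_isAdmissibleMinusTwist_nsmul (hd : d = -1 ∨ d = 2 ∨ d = -2)
    (P : (V.quadraticTwist (d : ℚ)).toAffine.Point) (hP : ¬ IsOfFinAddOrder P) :
    ∃ m : ℕ, m ≠ 0 ∧ V.IsAdmissibleMinusTwist 2 (d : ℚ) (m • P) := by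
  have hd0 : d ≠ 0 := by rcases hd with rfl | rfl | rfl <;> norm_num
  have hd0' : (d : ℚ) ≠ 0 := by exact_mod_cast hd0
  set C₂ : VariableChange ℚ := ⟨Units.mk0 (2 : ℚ) two_ne_zero, 0, 0, 0⟩ with hC₂
  set W := C₂⁻¹ • V.quadraticTwist (d : ℚ) with hWdef
  have hW : C₂ • W = V.quadraticTwist (d : ℚ) := smul_inv_smul C₂ _
  haveI : W.IsElliptic := V.isElliptic_of_scaleTwo_smul_eq d W hd0 hW
  haveI : W.IsIntegral ℤ := V.isIntegral_of_scaleTwo_smul_eq d W hW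
  set ψ := VariableChange.pointEquiv (V.quadraticTwist (d : ℚ)) C₂⁻¹ with hψ
  -- an admissible multiple of `ψ P` on `W`
  have hψP : ¬ IsOfFinAddOrder (ψ P) := fun h => hP (by simpa using ψ.symm.toAddMonoidHom.isOfFinAddOrder h)
  obtain ⟨m, hm0, hadm⟩ := W.exists_admissible_nsmul_of_isIntegral 2 (ψ P) hψP
  refine ⟨m, hm0, ?_⟩
  have hmP : ψ (m • P) = m • ψ P := map_nsmul ψ m P
  obtain ⟨hfin, hloc⟩ := hadm
  rw [← hmP] at hfin hloc
  refine ⟨fun h => hfin (ψ.toAddMonoidHom.isOfFinAddOrder h), ?_⟩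
  -- read the local conditions of `ψ(mP) = (X₁, Y₁)` back on `mP = (X₁/4, Y₁/8)`
  rcases hQ : m • P with _ | ⟨X, Y, h⟩
  · rw [hQ] at hloc
    have h0 : ψ Affine.Point.zero = 0 := map_zero ψ
    rw [h0] at hloc
    exact (W.not_satisfiesLocalConditions_zero 2 hloc).elim
  rw [hQ, hψ, VariableChange.pointEquiv_some] at hloc
  obtain ⟨hX₁, -, hns⟩ := hloc
  have htoX : (C₂⁻¹).toX X = 4 * X := by
    rw [VariableChange.toX_def, hC₂, VariableChange.inv_def]; simp; norm_num
  rw [htoX] at hX₁ hns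
  have hX₁' : 1 < ‖((4 * X : ℚ) : ℚ_[2])‖ := hX₁
  -- norms: `‖x′‖₂ = ‖4X‖₂/‖4d‖₂ ≥ 4‖4X‖₂`
  have hnd : ‖((4 * (d : ℚ) : ℚ) : ℚ_[2])‖ ≤ 4⁻¹ := by
    have h4 : ‖((4 : ℚ) : ℚ_[2])‖ = 4⁻¹ := by
      rw [show ((4 : ℚ) : ℚ_[2]) = ((2 : ℕ) : ℚ_[2]) ^ 2 by norm_num, norm_pow, Padic.norm_p]; norm_num
    push_cast
    rw [norm_mul]
    have : ‖((d : ℚ) : ℚ_[2])‖ ≤ 1 := by rw [Rat.cast_intCast]; exact Padic.norm_int_le_one d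
    calc ‖((4 : ℚ) : ℚ_[2])‖ * ‖((d : ℚ) : ℚ_[2])‖ ≤ 4⁻¹ * 1 := by
          rw [h4]; exact mul_le_mul_of_nonneg_left this (by norm_num)
      _ = 4⁻¹ := by norm_num
  have hnd0 : 0 < ‖((4 * (d : ℚ) : ℚ) : ℚ_[2])‖ := by
    rw [norm_pos_iff]; exact_mod_cast mul_ne_zero (by norm_num : (4 : ℚ) ≠ 0) hd0'
  have hx'eq : (((X / (d : ℚ) : ℚ)) : ℚ_[2]) = ((4 * X : ℚ) : ℚ_[2]) / ((4 * (d : ℚ) : ℚ) : ℚ_[2]) := by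
    push_cast; field_simp
  have hx'norm : 4 < ‖(((X / (d : ℚ) : ℚ)) : ℚ_[2])‖ := by
    rw [hx'eq, norm_div, lt_div_iff₀ hnd0]
    nlinarith [norm_nonneg (((4 * X : ℚ) : ℚ_[2]))]
  show _ ∧ _ ∧ _ ∧ _
  refine ⟨lt_trans (by norm_num) hx'norm, ?_, fun ℓ hℓ hℓ2 _ => ?_, fun h => (h rfl).elim⟩
  · -- the sigma disc: `‖x′⁻¹‖ < 2^{-2}`
    have hrad : ((2 : ℕ) : ℝ) ^ (-(2 / (((2 : ℕ) : ℝ) - 1))) = 4⁻¹ := by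
      rw [show (-(2 / (((2 : ℕ) : ℝ) - 1))) = ((-2 : ℤ) : ℝ) by norm_num, Real.rpow_intCast]; norm_num
    rw [hrad, norm_inv]
    exact (inv_lt_inv₀ (lt_trans (by norm_num) hx'norm) (by norm_num)).mpr hx'norm
  · -- the odd primes: §1
    have := V.hasNonsingularMinusReductionAt_of_twistModel d W hd hW
      ((VariableChange.nonsingular_iff (V.quadraticTwist (d : ℚ)) C₂⁻¹ X Y).mpr h) hℓ hℓ2
      (by rw [htoX]; exact hns ℓ hℓ)
    rwa [htoX, show (4 * X / 4 / (d : ℚ)) = X / d by field_simp] at this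

variable {V d} in
/-- **Uniqueness of the minus-twist height datum**: two `2`-adic height data on `V^{(d)}(ℚ)` with
`IsCanonicalSqMinusTwist` coincide (`d ∈ {−1, 2, −2}`), by admissible multiples and
`PAdicHeightData.ext_of_sq_eq_on`. [Mazur–Stein–Tate 2006, §1 («extends uniquely … h_p(nQ) = n²h_p(Q)»)]
[cite: MazurSteinTate2006, §1] -/
theorem PAdicHeightData.isCanonicalSqMinusTwist_unique (hd : d = -1 ∨ d = 2 ∨ d = -2)
    {D₁ D₂ : PAdicHeightData (V.quadraticTwist (d : ℚ)) 2}
    (h₁ : D₁.IsCanonicalSqMinusTwist) (h₂ : D₂.IsCanonicalSqMinusTwist) : D₁ = D₂ :=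
  PAdicHeightData.ext_of_sq_eq_on {P | V.IsAdmissibleMinusTwist 2 (d : ℚ) P}
    (V.exists_isAdmissibleMinusTwist_nsmul d hd) fun Q hQ => by rw [h₁ Q hQ, h₂ Q hQ]

/-- **THE canonical `2`-adic height datum on `V^{(−1)}(ℚ)` exists uniquely, minus-twist receptacle**
(`V/ℚ` elliptic, `ℤ`-integral, `V ⊗ ℚ₂` with a sigma-squared pair). [Mazur–Stein–Tate 2006, §1, §2.7;
Silverman 2005, §5 Rem. 2] [cite: MazurSteinTate2006, §2.7] [cite: Silverman2005DivPoly, §5 Rem. 2] -/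
theorem existsUnique_isCanonicalSqMinusTwist_neg_one
    (hex : ∃ Sq : ℚ_[2]⟦X⟧, ∃ c : ℚ_[2], (V.baseChange ℚ_[2]).IsMazurTateSigmaSqPair Sq c) :
    ∃! D : PAdicHeightData (V.quadraticTwist ((-1 : ℤ) : ℚ)) 2, D.IsCanonicalSqMinusTwist := by
  obtain ⟨D, hD⟩ := V.exists_isCanonicalSqMinusTwist_neg_one hex
  exact ⟨D, hD, fun D' hD' => PAdicHeightData.isCanonicalSqMinusTwist_unique (Or.inl rfl) hD' hD⟩

end Unique

/-! ### §3 The `−1`-twists of `49a1^{(4k+1)}`: binder-free -/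

section Cm7

variable (W : WeierstrassCurve ℚ) (k : ℤ)

/-- **THE canonical `2`-adic height datum on the minus part of `W_k^{(−1)}`, `W_k = 49a1^{(4k+1)}`
(integral model `y² + xy = x³ − (3k+1)x² − 2(4k+1)²x − (4k+1)³`), EXISTS UNIQUELY — no binder**: the
sigma-squared pair of `W_k ⊗ ℚ₂` is the square of the CM sigma function
(`cm7Twist_exists_isMazurTateSigmaSqPair_two`). This instantiates the `∀ D, IsCanonicalSqMinusTwist D → …`
binder of Bertrand's non-vanishing on the minus part (`bertrand_pairingSqMinusTwist_self_ne_zero_two`)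
for the class `d = −1`. [Perrin-Riou 1984, Ch. III §1.2 Lemme 2; Mazur–Stein–Tate 2006, §2.7;
Bertrand 1984, §3 Cor. 1] [cite: Perrinriou1984, Ch. III §1.2 Lemme 2] [cite: MazurSteinTate2006, §2.7] -/
theorem cm7Twist_existsUnique_isCanonicalSqMinusTwist_neg_one
    (hW : W = ⟨1, -(3 * (k : ℚ) + 1), 0, -2 * (4 * (k : ℚ) + 1) ^ 2, -(4 * (k : ℚ) + 1) ^ 3⟩) :
    ∃! D : PAdicHeightData (W.quadraticTwist ((-1 : ℤ) : ℚ)) 2, D.IsCanonicalSqMinusTwist := by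
  haveI : W.IsElliptic := cm7Twist_isElliptic W k hW
  haveI : W.IsIntegral ℤ := by
    subst hW
    exact isIntegral_of_exists_lift ℤ ⟨1, by simp⟩ ⟨-(3 * k + 1), by rw [eq_intCast]; push_cast; ring⟩
      ⟨0, by simp⟩ ⟨-2 * (4 * k + 1) ^ 2, by rw [eq_intCast]; push_cast; ring⟩
      ⟨-(4 * k + 1) ^ 3, by rw [eq_intCast]; push_cast; ring⟩
  exact W.existsUnique_isCanonicalSqMinusTwist_neg_one (cm7Twist_exists_isMazurTateSigmaSqPair_two W k hW)

end Cm7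

end WeierstrassCurve
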